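import Summits.QuantumAdvantage.AdviceFreeQNC0.CubeTwoPairCount
import HarnessLib

/-!
# Cell qa-qnc0 (rung F-Q1, route RingFrame, crux α, line `product`): `CubeCover` at `D = 2`, part 3/4 —
# rooted-cube counts and the seven re-parametrisations

The number `N(x)` of rooted 3-cubes at `x` (proper vertices `p₁, p₂, p₃, p₁⊕p₂⊕x, p₁⊕x⊕p₃,
p₂⊕x⊕p₃, p₁⊕p₂⊕p₃`) with all seven vertices in the class `S = cls_r` is `Σ_{p₃ ∈ S} P(x, p₃)`
(`cubeCount_eq_sum_pairCount`), and for `B ⊆ S` each of the seven counts "all vertices in `S`, the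
`k`-th vertex in `B`" equals `Σ_{w ∈ B} P(x, w)` (`badCount_*_eq`) — by re-parametrising the cube
through an xor-translation of one free vector (`sum_comp_xorLeft`) and the full symmetry of
`(a, b, c) ↦ a⊕b⊕c`.  See `WeightClassCubes.lean` (part 4) for the assembly.  WHAT THIS IS NOT:
nothing on α. [folklore]
-/
noncomputable section

namespace Summit.QuantumAdvantage.AdviceFreeQNC0

open Finset
open Literature.Computability.MetaComplexity.Hegedus

-- the machinery of the `D = 2` cube count lives in its own namespace `CubeTwo`.
namespace CubeTwo

variable {L : ℕ}

/-! ### Rooted cubes: counts -/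

/-- number of rooted 3-cubes at `x` (vertices `p₁, p₂, p₃, p₁⊕p₂⊕x, p₁⊕x⊕p₃, p₂⊕x⊕p₃, p₁⊕p₂⊕p₃`)
with all seven proper vertices in `S`. -/
def cubeCount (S : Finset (Fin L → Bool)) (x : Fin L → Bool) : ℕ :=
  ∑ p₃ : Fin L → Bool, ∑ p₁ : Fin L → Bool, ∑ p₂ : Fin L → Bool,
    if p₃ ∈ S ∧ p₁ ∈ S ∧ p₂ ∈ S ∧ x3 p₁ p₂ x ∈ S ∧ x3 p₁ x p₃ ∈ S ∧ x3 p₂ x p₃ ∈ S ∧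
        x3 p₁ p₂ p₃ ∈ S then 1 else 0

/-- number of such cubes with all vertices in `S` and the vertex selected by `k` in `B`:
`k = 1..7` ↦ `p₁, p₂, p₃, v₁₂, v₁₃, v₂₃, v₁₂₃`.  (Seven separate sums; no `Fin 7` bookkeeping.) -/
def badCount (S B : Finset (Fin L → Bool)) (x : Fin L → Bool)
    (sel : (Fin L → Bool) → (Fin L → Bool) → (Fin L → Bool) → (Fin L → Bool)) : ℕ :=
  ∑ p₃ : Fin L → Bool, ∑ p₁ : Fin L → Bool, ∑ p₂ : Fin L → Bool,
    if sel p₁ p₂ p₃ ∈ B ∧ (p₃ ∈ S ∧ p₁ ∈ S ∧ p₂ ∈ S ∧ x3 p₁ p₂ x ∈ S ∧ x3 p₁ x p₃ ∈ S ∧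
        x3 p₂ x p₃ ∈ S ∧ x3 p₁ p₂ p₃ ∈ S) then 1 else 0

/-! ### Indicator forms of the counts and the seven re-parametrisations -/

/-- indicator of the six pair conditions. -/
def ind6 (x y : Fin L → Bool) (r : ℕ) (q₁ q₂ : Fin L → Bool) : ℕ :=
  if wt q₁ % 3 = r % 3 ∧ wt q₂ % 3 = r % 3 ∧ wt (x3 q₁ q₂ x) % 3 = r % 3 ∧
      wt (x3 q₁ x y) % 3 = r % 3 ∧ wt (x3 q₂ x y) % 3 = r % 3 ∧ wt (x3 q₁ q₂ y) % 3 = r % 3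
    then 1 else 0

/-- `P(x,y)` as a double sum of `ind6`. [folklore] -/
theorem pairCount_eq_ind6 (x y : Fin L → Bool) (r : ℕ) :
    pairCount x y r = ∑ q₁ : Fin L → Bool, ∑ q₂ : Fin L → Bool, ind6 x y r q₁ q₂ := rfl

/-- indicator of "selected vertex in `B`, all seven vertices in `S`". -/
def ind7 (S B : Finset (Fin L → Bool)) (x : Fin L → Bool)
    (sel : (Fin L → Bool) → (Fin L → Bool) → (Fin L → Bool) → (Fin L → Bool))
    (p₁ p₂ p₃ : Fin L → Bool) : ℕ :=
  if sel p₁ p₂ p₃ ∈ B ∧ (p₃ ∈ S ∧ p₁ ∈ S ∧ p₂ ∈ S ∧ x3 p₁ p₂ x ∈ S ∧ x3 p₁ x p₃ ∈ S ∧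
      x3 p₂ x p₃ ∈ S ∧ x3 p₁ p₂ p₃ ∈ S) then 1 else 0

/-- `badCount` as a triple sum of `ind7`. [folklore] -/
theorem badCount_eq_ind7 (S B : Finset (Fin L → Bool)) (x : Fin L → Bool)
    (sel : (Fin L → Bool) → (Fin L → Bool) → (Fin L → Bool) → (Fin L → Bool)) :
    badCount S B x sel =
      ∑ p₃ : Fin L → Bool, ∑ p₁ : Fin L → Bool, ∑ p₂ : Fin L → Bool, ind7 S B x sel p₁ p₂ p₃ := rfl

/-- finishing step: `Σ_w Σ_a Σ_b [w ∈ B]·g = Σ_{w ∈ B} Σ_a Σ_b g`. [folklore] -/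
theorem sum_ite_mem_eq (B : Finset (Fin L → Bool)) (g : (Fin L → Bool) → (Fin L → Bool) → (Fin L → Bool) → ℕ) :
    ∑ w : Fin L → Bool, ∑ a : Fin L → Bool, ∑ b : Fin L → Bool, (if w ∈ B then g w a b else 0) =
      ∑ w ∈ B, ∑ a : Fin L → Bool, ∑ b : Fin L → Bool, g w a b := by
  have h : ∀ w : Fin L → Bool, (∑ a : Fin L → Bool, ∑ b : Fin L → Bool,
      (if w ∈ B then g w a b else 0)) =
        if w ∈ B then ∑ a : Fin L → Bool, ∑ b : Fin L → Bool, g w a b else 0 := by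
    intro w
    by_cases hw : w ∈ B
    · simp only [if_pos hw]
    · simp only [if_neg hw, Finset.sum_const_zero]
  simp_rw [h]
  rw [← Finset.sum_filter, Finset.filter_mem_eq_inter, Finset.univ_inter]

section Reparam

variable {r : ℕ} {S B : Finset (Fin L → Bool)}
  (hS : ∀ u : Fin L → Bool, u ∈ S ↔ wt u % 3 = r % 3) (hB : B ⊆ S)
include hS

/-- the class-cube indicator splits off the base condition `p₃ ∈ S`. -/
theorem ind_all7_eq (x p₁ p₂ p₃ : Fin L → Bool) :
    (if p₃ ∈ S ∧ p₁ ∈ S ∧ p₂ ∈ S ∧ x3 p₁ p₂ x ∈ S ∧ x3 p₁ x p₃ ∈ S ∧ x3 p₂ x p₃ ∈ S ∧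
        x3 p₁ p₂ p₃ ∈ S then (1 : ℕ) else 0) = if p₃ ∈ S then ind6 x p₃ r p₁ p₂ else 0 := by
  unfold ind6
  by_cases h3 : p₃ ∈ S
  · rw [if_pos h3]
    apply ite_congr_nat
    simp only [hS]
    constructor
    · rintro ⟨-, h1, h2, h12, h13, h23, h123⟩; exact ⟨h1, h2, h12, h13, h23, h123⟩
    · rintro ⟨h1, h2, h12, h13, h23, h123⟩; exact ⟨(hS p₃).1 h3, h1, h2, h12, h13, h23, h123⟩
  · rw [if_neg h3, if_neg fun h => h3 h.1]

/-- `N(x) = Σ_{p₃ ∈ cls} P(x, p₃)`. -/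
theorem cubeCount_eq_sum_pairCount (x : Fin L → Bool) :
    cubeCount S x = ∑ p₃ ∈ S, pairCount x p₃ r := by
  unfold cubeCount
  simp_rw [ind_all7_eq hS, pairCount_eq_ind6]
  exact sum_ite_mem_eq S fun p₃ p₁ p₂ => ind6 x p₃ r p₁ p₂

include hB

/-- bad vertex `p₃`: the indicator, pointwise. [folklore] -/
theorem ind7_p3 (x p₁ p₂ p₃ : Fin L → Bool) :
    ind7 S B x (fun _ _ p₃ => p₃) p₁ p₂ p₃ = if p₃ ∈ B then ind6 x p₃ r p₁ p₂ else 0 := by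
  unfold ind7 ind6
  by_cases hw : p₃ ∈ B
  · rw [if_pos hw]
    apply ite_congr_nat
    simp only [hS]
    constructor
    · rintro ⟨-, -, h1, h2, h12, h13, h23, h123⟩; exact ⟨h1, h2, h12, h13, h23, h123⟩
    · rintro ⟨h1, h2, h12, h13, h23, h123⟩
      exact ⟨hw, (hS p₃).1 (hB hw), h1, h2, h12, h13, h23, h123⟩
  · rw [if_neg hw, if_neg fun h => hw h.1]

/-- bad vertex `p₁`: the indicator, pointwise (pair `(p₂, p₃)` at `y = p₁`). [folklore] -/
theorem ind7_p1 (x p₁ p₂ p₃ : Fin L → Bool) :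
    ind7 S B x (fun p₁ _ _ => p₁) p₁ p₂ p₃ = if p₁ ∈ B then ind6 x p₁ r p₂ p₃ else 0 := by
  unfold ind7 ind6
  by_cases hw : p₁ ∈ B
  · rw [if_pos hw]
    apply ite_congr_nat
    simp only [hS]
    constructor
    · rintro ⟨-, h3, h1, h2, h12, h13, h23, h123⟩
      refine ⟨h2, h3, ?_, ?_, ?_, ?_⟩
      · rwa [x3_comm23 p₂ p₃ x]
      · rwa [← x3_cyc p₁ p₂ x]
      · rwa [x3_comm13 p₃ x p₁]
      · rwa [← x3_cyc p₁ p₂ p₃]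
    · rintro ⟨h2, h3, h23, h21, h31, h231⟩
      refine ⟨hw, h3, (hS p₁).1 (hB hw), h2, ?_, ?_, ?_, ?_⟩
      · rwa [← x3_cyc p₁ p₂ x] at h21
      · rwa [x3_comm13 p₃ x p₁] at h31
      · rwa [x3_comm23 p₂ p₃ x] at h23
      · rwa [← x3_cyc p₁ p₂ p₃] at h231
  · rw [if_neg hw, if_neg fun h => hw h.1]

/-- bad vertex `p₂`: the indicator, pointwise (pair `(p₁, p₃)` at `y = p₂`). [folklore] -/
theorem ind7_p2 (x p₁ p₂ p₃ : Fin L → Bool) :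
    ind7 S B x (fun _ p₂ _ => p₂) p₁ p₂ p₃ = if p₂ ∈ B then ind6 x p₂ r p₁ p₃ else 0 := by
  unfold ind7 ind6
  by_cases hw : p₂ ∈ B
  · rw [if_pos hw]
    apply ite_congr_nat
    simp only [hS]
    constructor
    · rintro ⟨-, h3, h1, h2, h12, h13, h23, h123⟩
      refine ⟨h1, h3, ?_, ?_, ?_, ?_⟩
      · rwa [← x3_comm23 p₁ x p₃]
      · rwa [← x3_comm23 p₁ p₂ x]
      · rwa [x3_comm13 p₃ x p₂]
      · rwa [← x3_comm23 p₁ p₂ p₃]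
    · rintro ⟨h1, h3, h13, h12, h32, h132⟩
      refine ⟨hw, h3, h1, (hS p₂).1 (hB hw), ?_, ?_, ?_, ?_⟩
      · rwa [← x3_comm23 p₁ p₂ x] at h12
      · rwa [← x3_comm23 p₁ x p₃] at h13
      · rwa [x3_comm13 p₃ x p₂] at h32
      · rwa [← x3_comm23 p₁ p₂ p₃] at h132
  · rw [if_neg hw, if_neg fun h => hw h.1]

/-- bad vertex `p₁⊕p₂⊕x =: w`: after `p₂ := p₁⊕x⊕w`, the indicator is that of the pair `(p₁, p₃)` at `y = w`. [folklore] -/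
theorem ind7_v12 (x p₁ p₃ w : Fin L → Bool) :
    ind7 S B x (fun p₁ p₂ _ => x3 p₁ p₂ x) p₁ (x3 p₁ x w) p₃ =
      if w ∈ B then ind6 x w r p₁ p₃ else 0 := by
  unfold ind7 ind6
  simp only [x3_cancel_mid, x3_sub_I5, x3_sub_I6]
  by_cases hw : w ∈ B
  · rw [if_pos hw]
    apply ite_congr_nat
    simp only [hS]
    constructor
    · rintro ⟨-, h3, h1, h2, -, h13, h23, h123⟩
      refine ⟨h1, h3, ?_, h2, ?_, ?_⟩
      · rwa [← x3_comm23 p₁ x p₃]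
      · rwa [← x3_cyc2 x w p₃]
      · rwa [← x3_comm23 p₁ w p₃]
    · rintro ⟨h1, h3, h13, h2, h3w, h13w⟩
      refine ⟨hw, h3, h1, h2, (hS w).1 (hB hw), ?_, ?_, ?_⟩
      · rwa [← x3_comm23 p₁ x p₃] at h13
      · rwa [← x3_comm23 p₁ w p₃] at h13w
      · rwa [← x3_cyc2 x w p₃] at h3w
  · rw [if_neg hw, if_neg fun h => hw h.1]

/-- bad vertex `p₁⊕x⊕p₃ =: w`: after `p₃ := p₁⊕x⊕w`, the pair `(p₁, p₂)` at `y = w`. [folklore] -/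
theorem ind7_v13 (x p₁ p₂ w : Fin L → Bool) :
    ind7 S B x (fun p₁ _ p₃ => x3 p₁ x p₃) p₁ p₂ (x3 p₁ x w) =
      if w ∈ B then ind6 x w r p₁ p₂ else 0 := by
  unfold ind7 ind6
  simp only [x3_cancel_right, x3_sub_I8, x3_sub_I9]
  by_cases hw : w ∈ B
  · rw [if_pos hw]
    apply ite_congr_nat
    simp only [hS]
    constructor
    · rintro ⟨-, h3, h1, h2, h12, -, h23, h123⟩
      refine ⟨h1, h2, h12, h3, h123, ?_⟩
      rwa [x3_comm12 p₂ p₁ w] at h23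
    · rintro ⟨h1, h2, h12, h3, h2w, h12w⟩
      refine ⟨hw, h3, h1, h2, h12, (hS w).1 (hB hw), ?_, h2w⟩
      rwa [x3_comm12 p₂ p₁ w]
  · rw [if_neg hw, if_neg fun h => hw h.1]

/-- bad vertex `p₂⊕x⊕p₃ =: w`: after `p₃ := p₂⊕x⊕w`, the pair `(p₁, p₂)` at `y = w`. [folklore] -/
theorem ind7_v23 (x p₁ p₂ w : Fin L → Bool) :
    ind7 S B x (fun _ p₂ p₃ => x3 p₂ x p₃) p₁ p₂ (x3 p₂ x w) =
      if w ∈ B then ind6 x w r p₁ p₂ else 0 := by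
  unfold ind7 ind6
  simp only [x3_cancel_right, x3_sub_I8, x3_sub_I10]
  by_cases hw : w ∈ B
  · rw [if_pos hw]
    apply ite_congr_nat
    simp only [hS]
    constructor
    · rintro ⟨-, h3, h1, h2, h12, h13, -, h123⟩
      exact ⟨h1, h2, h12, h123, h3, h13⟩
    · rintro ⟨h1, h2, h12, h1w, h2w, h12w⟩
      exact ⟨hw, h2w, h1, h2, h12, h12w, (hS w).1 (hB hw), h1w⟩
  · rw [if_neg hw, if_neg fun h => hw h.1]

/-- bad vertex `p₁⊕p₂⊕p₃ =: w`: after `p₃ := p₁⊕p₂⊕w`, the pair `(p₁, p₂)` at `y = w`. [folklore] -/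
theorem ind7_v123 (x p₁ p₂ w : Fin L → Bool) :
    ind7 S B x (fun p₁ p₂ p₃ => x3 p₁ p₂ p₃) p₁ p₂ (x3 p₁ p₂ w) =
      if w ∈ B then ind6 x w r p₁ p₂ else 0 := by
  unfold ind7 ind6
  simp only [x3_cancel_right, x3_sub_I9, x3_sub_I11]
  by_cases hw : w ∈ B
  · rw [if_pos hw]
    apply ite_congr_nat
    simp only [hS]
    constructor
    · rintro ⟨-, h3, h1, h2, h12, h13, h23, -⟩
      refine ⟨h1, h2, h12, ?_, ?_, h3⟩
      · rwa [x3_comm12 x p₁ w] at h23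
      · rwa [x3_comm12 x p₂ w] at h13
    · rintro ⟨h1, h2, h12, h1w, h2w, h12w⟩
      refine ⟨hw, h12w, h1, h2, h12, ?_, ?_, (hS w).1 (hB hw)⟩
      · rwa [x3_comm12 x p₂ w]
      · rwa [x3_comm12 x p₁ w]
  · rw [if_neg hw, if_neg fun h => hw h.1]

/-! #### the seven bad counts all equal `Σ_{w ∈ B} P(x,w)` -/

/-- bad-`p₃` count `= Σ_{w ∈ B} P(x,w)`. [folklore] -/
theorem badCount_p3_eq (x : Fin L → Bool) :
    badCount S B x (fun _ _ p₃ => p₃) = ∑ w ∈ B, pairCount x w r := by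
  rw [badCount_eq_ind7]
  simp_rw [ind7_p3 hS hB, pairCount_eq_ind6]
  exact sum_ite_mem_eq B fun w p₁ p₂ => ind6 x w r p₁ p₂

/-- bad-`p₁` count `= Σ_{w ∈ B} P(x,w)`. [folklore] -/
theorem badCount_p1_eq (x : Fin L → Bool) :
    badCount S B x (fun p₁ _ _ => p₁) = ∑ w ∈ B, pairCount x w r := by
  rw [badCount_eq_ind7, Finset.sum_comm]
  simp_rw [ind7_p1 hS hB, pairCount_eq_ind6]
  rw [← sum_ite_mem_eq B fun w p₂ p₃ => ind6 x w r p₂ p₃]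
  exact Finset.sum_congr rfl fun p₁ _ => Finset.sum_comm

/-- bad-`p₂` count `= Σ_{w ∈ B} P(x,w)`. [folklore] -/
theorem badCount_p2_eq (x : Fin L → Bool) :
    badCount S B x (fun _ p₂ _ => p₂) = ∑ w ∈ B, pairCount x w r := by
  rw [badCount_eq_ind7]
  simp_rw [ind7_p2 hS hB, pairCount_eq_ind6]
  rw [← sum_ite_mem_eq B fun w p₁ p₃ => ind6 x w r p₁ p₃]
  calc ∑ p₃ : Fin L → Bool, ∑ p₁ : Fin L → Bool, ∑ p₂ : Fin L → Bool,
        (if p₂ ∈ B then ind6 x p₂ r p₁ p₃ else 0)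
      = ∑ p₃ : Fin L → Bool, ∑ p₂ : Fin L → Bool, ∑ p₁ : Fin L → Bool,
          (if p₂ ∈ B then ind6 x p₂ r p₁ p₃ else 0) :=
        Finset.sum_congr rfl fun p₃ _ => Finset.sum_comm
    _ = ∑ p₂ : Fin L → Bool, ∑ p₃ : Fin L → Bool, ∑ p₁ : Fin L → Bool,
          (if p₂ ∈ B then ind6 x p₂ r p₁ p₃ else 0) := Finset.sum_comm
    _ = ∑ p₂ : Fin L → Bool, ∑ p₁ : Fin L → Bool, ∑ p₃ : Fin L → Bool,
          (if p₂ ∈ B then ind6 x p₂ r p₁ p₃ else 0) :=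
        Finset.sum_congr rfl fun p₂ _ => Finset.sum_comm

/-- bad-`(p₁⊕p₂⊕x)` count `= Σ_{w ∈ B} P(x,w)`. [folklore] -/
theorem badCount_v12_eq (x : Fin L → Bool) :
    badCount S B x (fun p₁ p₂ _ => x3 p₁ p₂ x) = ∑ w ∈ B, pairCount x w r := by
  rw [badCount_eq_ind7]
  have sub : ∀ p₃ p₁ : Fin L → Bool,
      (∑ p₂ : Fin L → Bool, ind7 S B x (fun p₁ p₂ _ => x3 p₁ p₂ x) p₁ p₂ p₃) =
        ∑ w : Fin L → Bool, (if w ∈ B then ind6 x w r p₁ p₃ else 0) := by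
    intro p₃ p₁
    rw [← sum_comp_xorLeft (fun i => xor (p₁ i) (x i))
      (fun p₂ => ind7 S B x (fun p₁ p₂ _ => x3 p₁ p₂ x) p₁ p₂ p₃)]
    refine Finset.sum_congr rfl fun w _ => ?_
    exact ind7_v12 hS hB x p₁ p₃ w
  simp_rw [sub, pairCount_eq_ind6]
  rw [← sum_ite_mem_eq B fun w p₁ p₃ => ind6 x w r p₁ p₃]
  calc ∑ p₃ : Fin L → Bool, ∑ p₁ : Fin L → Bool, ∑ w : Fin L → Bool,
        (if w ∈ B then ind6 x w r p₁ p₃ else 0)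
      = ∑ p₃ : Fin L → Bool, ∑ w : Fin L → Bool, ∑ p₁ : Fin L → Bool,
          (if w ∈ B then ind6 x w r p₁ p₃ else 0) :=
        Finset.sum_congr rfl fun p₃ _ => Finset.sum_comm
    _ = ∑ w : Fin L → Bool, ∑ p₃ : Fin L → Bool, ∑ p₁ : Fin L → Bool,
          (if w ∈ B then ind6 x w r p₁ p₃ else 0) := Finset.sum_comm
    _ = ∑ w : Fin L → Bool, ∑ p₁ : Fin L → Bool, ∑ p₃ : Fin L → Bool,
          (if w ∈ B then ind6 x w r p₁ p₃ else 0) :=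
        Finset.sum_congr rfl fun w _ => Finset.sum_comm

/-- bad-`(p₁⊕x⊕p₃)` count `= Σ_{w ∈ B} P(x,w)`. [folklore] -/
theorem badCount_v13_eq (x : Fin L → Bool) :
    badCount S B x (fun p₁ _ p₃ => x3 p₁ x p₃) = ∑ w ∈ B, pairCount x w r := by
  rw [badCount_eq_ind7, Finset.sum_comm]
  -- now `Σ p₁, Σ p₃, Σ p₂`; substitute `p₃ := x3 p₁ x w`
  have sub : ∀ p₁ : Fin L → Bool,
      (∑ p₃ : Fin L → Bool, ∑ p₂ : Fin L → Bool,
          ind7 S B x (fun p₁ _ p₃ => x3 p₁ x p₃) p₁ p₂ p₃) =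
        ∑ w : Fin L → Bool, ∑ p₂ : Fin L → Bool, (if w ∈ B then ind6 x w r p₁ p₂ else 0) := by
    intro p₁
    rw [← sum_comp_xorLeft (fun i => xor (p₁ i) (x i))
      (fun p₃ => ∑ p₂ : Fin L → Bool, ind7 S B x (fun p₁ _ p₃ => x3 p₁ x p₃) p₁ p₂ p₃)]
    refine Finset.sum_congr rfl fun w _ => Finset.sum_congr rfl fun p₂ _ => ?_
    exact ind7_v13 hS hB x p₁ p₂ w
  simp_rw [sub, pairCount_eq_ind6]
  rw [← sum_ite_mem_eq B fun w p₁ p₂ => ind6 x w r p₁ p₂]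
  exact Finset.sum_comm

/-- bad-`(p₂⊕x⊕p₃)` count `= Σ_{w ∈ B} P(x,w)`. [folklore] -/
theorem badCount_v23_eq (x : Fin L → Bool) :
    badCount S B x (fun _ p₂ p₃ => x3 p₂ x p₃) = ∑ w ∈ B, pairCount x w r := by
  rw [badCount_eq_ind7, Finset.sum_comm]
  -- now `Σ p₁, Σ p₃, Σ p₂`; swap inner to `Σ p₁, Σ p₂, Σ p₃`, substitute `p₃ := x3 p₂ x w`
  have sub : ∀ p₁ : Fin L → Bool,
      (∑ p₃ : Fin L → Bool, ∑ p₂ : Fin L → Bool,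
          ind7 S B x (fun _ p₂ p₃ => x3 p₂ x p₃) p₁ p₂ p₃) =
        ∑ w : Fin L → Bool, ∑ p₂ : Fin L → Bool, (if w ∈ B then ind6 x w r p₁ p₂ else 0) := by
    intro p₁
    rw [Finset.sum_comm]
    have inner : ∀ p₂ : Fin L → Bool,
        (∑ p₃ : Fin L → Bool, ind7 S B x (fun _ p₂ p₃ => x3 p₂ x p₃) p₁ p₂ p₃) =
          ∑ w : Fin L → Bool, (if w ∈ B then ind6 x w r p₁ p₂ else 0) := by
      intro p₂
      rw [← sum_comp_xorLeft (fun i => xor (p₂ i) (x i))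
        (fun p₃ => ind7 S B x (fun _ p₂ p₃ => x3 p₂ x p₃) p₁ p₂ p₃)]
      refine Finset.sum_congr rfl fun w _ => ?_
      exact ind7_v23 hS hB x p₁ p₂ w
    simp_rw [inner]
    exact Finset.sum_comm
  simp_rw [sub, pairCount_eq_ind6]
  rw [← sum_ite_mem_eq B fun w p₁ p₂ => ind6 x w r p₁ p₂]
  exact Finset.sum_comm

/-- bad-`(p₁⊕p₂⊕p₃)` count `= Σ_{w ∈ B} P(x,w)`. [folklore] -/
theorem badCount_v123_eq (x : Fin L → Bool) :
    badCount S B x (fun p₁ p₂ p₃ => x3 p₁ p₂ p₃) = ∑ w ∈ B, pairCount x w r := by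
  rw [badCount_eq_ind7, Finset.sum_comm]
  have sub : ∀ p₁ : Fin L → Bool,
      (∑ p₃ : Fin L → Bool, ∑ p₂ : Fin L → Bool,
          ind7 S B x (fun p₁ p₂ p₃ => x3 p₁ p₂ p₃) p₁ p₂ p₃) =
        ∑ w : Fin L → Bool, ∑ p₂ : Fin L → Bool, (if w ∈ B then ind6 x w r p₁ p₂ else 0) := by
    intro p₁
    rw [Finset.sum_comm]
    have inner : ∀ p₂ : Fin L → Bool,
        (∑ p₃ : Fin L → Bool, ind7 S B x (fun p₁ p₂ p₃ => x3 p₁ p₂ p₃) p₁ p₂ p₃) =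
          ∑ w : Fin L → Bool, (if w ∈ B then ind6 x w r p₁ p₂ else 0) := by
      intro p₂
      rw [← sum_comp_xorLeft (fun i => xor (p₁ i) (p₂ i))
        (fun p₃ => ind7 S B x (fun p₁ p₂ p₃ => x3 p₁ p₂ p₃) p₁ p₂ p₃)]
      refine Finset.sum_congr rfl fun w _ => ?_
      exact ind7_v123 hS hB x p₁ p₂ w
    simp_rw [inner]
    exact Finset.sum_comm
  simp_rw [sub, pairCount_eq_ind6]
  rw [← sum_ite_mem_eq B fun w p₁ p₂ => ind6 x w r p₁ p₂]
  exact Finset.sum_comm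

end Reparam

end CubeTwo

end Summit.QuantumAdvantage.AdviceFreeQNC0

end
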